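import Literature.MathematicalPhysics.QuantumFieldTheory.Balaban1983to89.B9CoReadingCoords
import Literature.MathematicalPhysics.QuantumFieldTheory.Balaban1983to89.B9Ineq347CoReadingAtLetters
import Literature.MathematicalPhysics.QuantumFieldTheory.Balaban1983to89.B9RWSums343to347Whole

/-!
# `Balaban1983to89.B9CoReadingCoordsGlob` — the (3.47) co-readings `CoReadsGlob` (n06-l) and `GlobReads` (n06-k) of def-Y's bond-sector reading
# `kernelFamilyB` HOLD on the κ-fold coordinate model of `B9CoReadingCoords`, every entry, every letter, every `U` — no domination hypothesis

T. Bałaban, *Propagators for lattice gauge theories in a background field*, Commun. Math. Phys. **99** (1985) 389–434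
[`Balaban1985BackgroundPropagators`, "B9"]; [4] = T. Bałaban, *Propagators and renormalization transformations for lattice gauge
theories. II*, Commun. Math. Phys. **96** (1984) 223–250 [`Balaban1984PropagatorsII`].

statement-level skeleton of published theorems with citation tags; proofs where landed; nothing here is a claim about the
Yang–Mills mass gap

THE PRINTED LOCI.  (3.41) p. 397 *"|A|_{(α)} = sup_j sup_{b ∈ Ω_j∖Ω_{j+1}} (Lʲη)^{−α}|A(b)| … the smallest number C such, that |A(b)| ≤ C(Lʲη)^α"*;
(3.47) p. 398 *"|G(U)J|_{(2+γ)}, |∇_U G(U)J|_{(1+γ)}, |G(U)∇*_U J|_{(1+γ)}, |Δ_U G(U)J|_{(γ)} ≤ B₀|J|_{(γ)}"*.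

WHY THIS FILE (sequel of `B9CoReadingCoords`, seat n06-d g4 OFFER-1).  The N06 knit displays the (3.47) co-readings of the bond-sector letters in two fibre-free
species: n06-l's `B9Ineq347CoReading.CoReadsGlob K n U bu bv ev A` (rows 20–21, `hcoG`) and n06-k's `B9RWSums343to347Whole.GlobReads K n U bu bv ev T` (rows 18–19,
`hgl`).  Both are «dischargeable by domination» (n06-l `B9Ineq347CoReadingAtLetters.coReadsGlob_zero_kernelFamilyB`, hypothesis `‖O(U)(J ⊗ E)(x)‖ ≤ |(AJ)(x)|`), which
at U ≠ 1 no real-scalar model meets.  On the κ-fold coordinate carrier `XBK κ i = FBondY × Fin (d+1) × κ × κ` with the models `GcoK ∕ DcoK ∘ GcoK ∕ GcoK ∘ DscoK ∕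
LcoK ∘ GcoK` of `B9CoReadingCoords` BOTH species hold for every entry, every letter `O`, every `U₁`, given only a LEVEL-FAITHFUL block map `bI` on the fine bonds
(`lvl (bI x) = level of the block of x`; exists at every member, n06-l `B9IndexBondAtLevel` ∕ `exists_carrierFaithful`):
* §1 `norm_le_of_coordModel_le_pt` (the pointwise core: a coordinate bound `g x` at the fine bond `x` on the scaled model gives `‖(T ν (J ⊗ E))(x)‖ ≤ g x`),
  `glob_le_of_pointwise_zero ∕ _one ∕ _two ∕ _three` (the (3.47) reading of entry n is `≤ c` as soon as its integrand is `≤ c·(L^{j(x)}η)^{p_n+γ}` pointwise —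
  def-Y's `wNormBY` through n06-h's `wNormBY_le_of_pointwise`), `evBK_wbound` (the (3.41) domination of the diagonal evaluation);
* §2 ★★ `coReadsGlob_kernelFamilyB_coords_zero ∕ _one ∕ _two ∕ _three` (n06-l's species) and ★★ `globReads_kernelFamilyB_coords_zero ∕ _one ∕ _two ∕ _three`
  (n06-k's species) — the knit's binders `hcoG12 hcoG13` (rows 20–21) and `hglA0‥3` (row 19) become `have`s under the same pins as the (3.42) co-readings.
HONEST SCOPE.  Finite-dimensional bookkeeping over def-Y's readings; the site sector (`kernelFamilyS`, rows 18 ∕ 20's G′) is not treated; nothing of [B9] or [4]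
asserted; COUNT-NEUTRAL; N06 NOT discharged; one finite 𝕋⁴ programme — nothing continuum, nothing about the mass gap.  Cell `pub-ymgap` (HUMAN RULING D-0062),
Track A node N06 [B9], seat `pub-ymgap-dag-n06-d` (g4), 2026-08-27.
-/

noncomputable section

namespace Literature.MathematicalPhysics.QuantumFieldTheory.Balaban1983to89.B9CoReadingCoordsGlob

open B6SectAOperatorsV1 (BondIdx)
open B6GlobalChartV1 (PV domT blkV1)
open B6Ineq2142KLevelV1 (β lvl)
open B6KLevelCensusIndexV1 (KIdx)
open B9GeoNormsKLevelV1 (geo9K wNormB geo9K_wNorm_nonneg abs_le_of_wNormB_le)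
open B9Ineq347CoReading (CoReadsGlob)
open B9RWSums343to347Whole (GlobReads)
open B9Ineq347GAAtLetters (wNormBY_le_of_pointwise)
open B9Ineq347CoReadingAtLetters (len_bI_eq)
open B9Thm39ReadingCoords (cR39 cR39_nonneg)
open B9CoReadingCoords (evDiagK abs_evDiagK_le coordOpK coordOpK_evDiagK norm_apply_liftY_le cdBₗ cdsBₗ lapBₗ lapBₗ_apply XBK evBK blkBK GcoK DcoK DscoK LcoK
  DcoK_comp_GcoK GcoK_comp_DscoK LcoK_comp_GcoK)
open Node00 (SiteY FBondY BlkY IBondY CfgY BallY liftY wNormBY kernelFamilyB BondOpY BondParY cdB cdsB lapB iSup_ball_le)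

variable {d ℓ : ℕ} {hd : 1 ≤ d + 1} {hL : Odd (ℓ + 1) ∧ 1 < ℓ + 1} {b₀ b₁ : ℝ}
variable {𝔸 : Type} [NormedRing 𝔸] [NormedAlgebra ℂ 𝔸] [CompleteSpace 𝔸] [FiniteDimensional ℝ 𝔸]
variable {κ : Type} [Fintype κ] [DecidableEq κ]

section Core

variable (i : KIdx d ℓ hd hL b₀ b₁) (b : Module.Basis κ ℝ 𝔸)

/-- ★ **THE POINTWISE CORE**: if the scaled coordinate model of a family `T` at the diagonal evaluation of `J` is `≤ g x` in absolute value at every point over the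
fine bond `x`, then `‖(T ν (J ⊗ E))(x)‖ ≤ g x` for `‖E‖ ≤ 1` and every direction slot `ν`.
[cite: Balaban1985BackgroundPropagators, (3.39) + (3.41) p.397; Balaban1984PropagatorsII, (2.51) p.232] -/
theorem norm_le_of_coordModel_le_pt (T : Fin (d + 1) → (FBondY i → 𝔸) →ₗ[ℝ] (FBondY i → 𝔸)) (J : FBondY i → ℝ) (x : FBondY i) {g : ℝ} (hg : 0 ≤ g)
    (h : ∀ (ν : Fin (d + 1)) (c c' : κ), |(cR39 b • coordOpK b T) (evDiagK J) (x, ν, c, c')| ≤ g) (E : BallY 𝔸) (ν : Fin (d + 1)) :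
    ‖T ν (liftY J (E : 𝔸)) x‖ ≤ g := by
  have hE : ‖(E : 𝔸)‖ ≤ 1 := mem_closedBall_zero_iff.1 E.2
  have hcoord : ∀ cc cc' : κ, cR39 b * |b.repr (T ν (liftY J (b cc')) x) cc| ≤ g := by
    intro cc cc'
    have := h ν cc cc'
    rwa [LinearMap.smul_apply, Pi.smul_apply, coordOpK_evDiagK, smul_eq_mul, abs_mul, abs_of_nonneg (cR39_nonneg b)] at this
  rcases isEmpty_or_nonempty κ with hκ | hκ
  · have hA : ∀ v : 𝔸, v = 0 := fun v => by
      rw [← b.sum_repr v]; exact Finset.sum_eq_zero fun c _ => (hκ.false c).elim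
    rw [hA (T ν (liftY J (E : 𝔸)) x), norm_zero]; exact hg
  · obtain ⟨q, -, hq⟩ := Finset.exists_max_image (Finset.univ : Finset (κ × κ)) (fun q => |b.repr (T ν (liftY J (b q.2)) x) q.1|)
      Finset.univ_nonempty
    have hM : ∀ cc cc' : κ, |b.repr (T ν (liftY J (b cc')) x) cc| ≤ |b.repr (T ν (liftY J (b q.2)) x) q.1| :=
      fun cc cc' => hq (cc, cc') (Finset.mem_univ _)
    exact (norm_apply_liftY_le b (T ν) J hE x hM).trans (hcoord q.1 q.2)

/-- the scale length of the fine bond `x` in the units of the record: `L^{j(x)}|c_f|⁻¹`. [cite: Balaban1985BackgroundPropagators, (3.41) p.397, dictionary] -/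
def lenFB (x : FBondY i) : ℝ := ((ℓ : ℝ) + 1) ^ (blkV1 i.hN i.D x).1.1 * |i.cf|⁻¹

/-- `0 < lenFB i x`. [cite: Balaban1985BackgroundPropagators, (3.41) p.397, bookkeeping] -/
theorem lenFB_pos (x : FBondY i) : 0 < lenFB i x := mul_pos (pow_pos (by positivity) _) (inv_pos.2 (abs_pos.2 i.hcf))

/-- `t² · t^γ = t^{2+γ}` for `t = lenFB i x > 0`. [folklore] -/
private theorem sq_mul_rpow_lenFB (x : FBondY i) (γ : ℝ) : lenFB i x ^ 2 * lenFB i x ^ γ = lenFB i x ^ ((2 : ℝ) + γ) := by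
  rw [Real.rpow_add (lenFB_pos i x), Real.rpow_two]

/-- `t · t^γ = t^{1+γ}` for `t = lenFB i x > 0`. [folklore] -/
private theorem mul_rpow_lenFB (x : FBondY i) (γ : ℝ) : lenFB i x * lenFB i x ^ γ = lenFB i x ^ ((1 : ℝ) + γ) := by
  rw [Real.rpow_add (lenFB_pos i x), Real.rpow_one]

variable (B : B9.Backgrounds) (cfg : B.Cfg → CfgY 𝔸 i) (O : BondOpY 𝔸 i) (par : BondParY 𝔸 i) (U₁ : B.Cfg)

omit [FiniteDimensional ℝ 𝔸] in
/-- entry 0 of the (3.47) reading is `≤ c` when `‖(O(U)(J ⊗ E))(x)‖ ≤ c·(L^{j(x)}η)^{2+γ}` pointwise. [cite: Balaban1985BackgroundPropagators, (3.41) p.397 + (3.47) p.398] -/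
theorem glob_zero_le_of_pointwise (J : FBondY i → ℝ) (γ : ℝ) {c : ℝ} (hc : 0 ≤ c)
    (h : ∀ (E : BallY 𝔸) (x : FBondY i), ‖O (cfg U₁) (liftY J (E : 𝔸)) x‖ ≤ c * lenFB i x ^ ((2 : ℝ) + γ)) :
    (kernelFamilyB i B cfg O par).glob 0 U₁ (Sum.inr J) γ ≤ c := by
  show (⨆ E : BallY 𝔸, ((![wNormBY i (2 + γ) (O (cfg U₁) (liftY J (E : 𝔸))),
      ⨆ ν : Fin (d + 1), wNormBY i (1 + γ) (cdB i (cfg U₁) ν (O (cfg U₁) (liftY J (E : 𝔸)))),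
      ⨆ ν : Fin (d + 1), wNormBY i (1 + γ) (O (cfg U₁) (cdsB i (cfg U₁) ν (liftY J (E : 𝔸)))),
      wNormBY i γ (lapB i (cfg U₁) (O (cfg U₁) (liftY J (E : 𝔸))))] : Fin 4 → ℝ) 0)) ≤ c
  refine iSup_ball_le (fun E => ?_) hc
  simp only [Matrix.cons_val_zero]
  exact wNormBY_le_of_pointwise i hc fun x => h E x

omit [FiniteDimensional ℝ 𝔸] in
/-- entry 1 of the (3.47) reading is `≤ c` when `‖(∇_{U,ν} O(U)(J ⊗ E))(x)‖ ≤ c·(L^{j(x)}η)^{1+γ}` pointwise. [cite: Balaban1985BackgroundPropagators, (3.41) p.397 + (3.47) p.398] -/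
theorem glob_one_le_of_pointwise (J : FBondY i → ℝ) (γ : ℝ) {c : ℝ} (hc : 0 ≤ c)
    (h : ∀ (E : BallY 𝔸) (ν : Fin (d + 1)) (x : FBondY i), ‖cdB i (cfg U₁) ν (O (cfg U₁) (liftY J (E : 𝔸))) x‖ ≤ c * lenFB i x ^ ((1 : ℝ) + γ)) :
    (kernelFamilyB i B cfg O par).glob 1 U₁ (Sum.inr J) γ ≤ c := by
  show (⨆ E : BallY 𝔸, ((![wNormBY i (2 + γ) (O (cfg U₁) (liftY J (E : 𝔸))),
      ⨆ ν : Fin (d + 1), wNormBY i (1 + γ) (cdB i (cfg U₁) ν (O (cfg U₁) (liftY J (E : 𝔸)))),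
      ⨆ ν : Fin (d + 1), wNormBY i (1 + γ) (O (cfg U₁) (cdsB i (cfg U₁) ν (liftY J (E : 𝔸)))),
      wNormBY i γ (lapB i (cfg U₁) (O (cfg U₁) (liftY J (E : 𝔸))))] : Fin 4 → ℝ) 1)) ≤ c
  refine iSup_ball_le (fun E => ?_) hc
  simp only [Matrix.cons_val_one, Matrix.cons_val_zero]
  exact Real.iSup_le (fun ν => wNormBY_le_of_pointwise i hc fun x => h E ν x) hc

omit [FiniteDimensional ℝ 𝔸] in
/-- entry 2 of the (3.47) reading is `≤ c` when `‖(O(U) ∇*_{U,ν}(J ⊗ E))(x)‖ ≤ c·(L^{j(x)}η)^{1+γ}` pointwise. [cite: Balaban1985BackgroundPropagators, (3.41) p.397 + (3.47) p.398] -/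
theorem glob_two_le_of_pointwise (J : FBondY i → ℝ) (γ : ℝ) {c : ℝ} (hc : 0 ≤ c)
    (h : ∀ (E : BallY 𝔸) (ν : Fin (d + 1)) (x : FBondY i), ‖O (cfg U₁) (cdsB i (cfg U₁) ν (liftY J (E : 𝔸))) x‖ ≤ c * lenFB i x ^ ((1 : ℝ) + γ)) :
    (kernelFamilyB i B cfg O par).glob 2 U₁ (Sum.inr J) γ ≤ c := by
  show (⨆ E : BallY 𝔸, ((![wNormBY i (2 + γ) (O (cfg U₁) (liftY J (E : 𝔸))),
      ⨆ ν : Fin (d + 1), wNormBY i (1 + γ) (cdB i (cfg U₁) ν (O (cfg U₁) (liftY J (E : 𝔸)))),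
      ⨆ ν : Fin (d + 1), wNormBY i (1 + γ) (O (cfg U₁) (cdsB i (cfg U₁) ν (liftY J (E : 𝔸)))),
      wNormBY i γ (lapB i (cfg U₁) (O (cfg U₁) (liftY J (E : 𝔸))))] : Fin 4 → ℝ) 2)) ≤ c
  refine iSup_ball_le (fun E => ?_) hc
  simp only [Matrix.cons_val_two, Matrix.tail_cons, Matrix.head_cons]
  exact Real.iSup_le (fun ν => wNormBY_le_of_pointwise i hc fun x => h E ν x) hc

omit [FiniteDimensional ℝ 𝔸] in
/-- entry 3 of the (3.47) reading is `≤ c` when `‖(Δ_U O(U)(J ⊗ E))(x)‖ ≤ c·(L^{j(x)}η)^{γ}` pointwise. [cite: Balaban1985BackgroundPropagators, (3.41) p.397 + (3.47) p.398] -/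
theorem glob_three_le_of_pointwise (J : FBondY i → ℝ) (γ : ℝ) {c : ℝ} (hc : 0 ≤ c)
    (h : ∀ (E : BallY 𝔸) (x : FBondY i), ‖lapB i (cfg U₁) (O (cfg U₁) (liftY J (E : 𝔸))) x‖ ≤ c * lenFB i x ^ γ) :
    (kernelFamilyB i B cfg O par).glob 3 U₁ (Sum.inr J) γ ≤ c := by
  show (⨆ E : BallY 𝔸, ((![wNormBY i (2 + γ) (O (cfg U₁) (liftY J (E : 𝔸))),
      ⨆ ν : Fin (d + 1), wNormBY i (1 + γ) (cdB i (cfg U₁) ν (O (cfg U₁) (liftY J (E : 𝔸)))),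
      ⨆ ν : Fin (d + 1), wNormBY i (1 + γ) (O (cfg U₁) (cdsB i (cfg U₁) ν (liftY J (E : 𝔸)))),
      wNormBY i γ (lapB i (cfg U₁) (O (cfg U₁) (liftY J (E : 𝔸))))] : Fin 4 → ℝ) 3)) ≤ c
  refine iSup_ball_le (fun E => ?_) hc
  simp only [Matrix.cons_val_three, Matrix.tail_cons, Matrix.head_cons]
  exact wNormBY_le_of_pointwise i hc fun x => h E x

omit [FiniteDimensional ℝ 𝔸] [Fintype κ] in
/-- **the (3.41) domination of the diagonal evaluation**: `|evBK lam p| ≤ (L^{j}η)(bI p.1)^γ · |lam|_{(γ)}` for a LEVEL-FAITHFUL block map `bI`.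
[cite: Balaban1985BackgroundPropagators, (3.41) p.397] -/
theorem evBK_wbound {bI : FBondY i → IBondY i} (hlev : ∀ x : FBondY i, lvl i.hN i.D i.hk (bI x) = (blkV1 i.hN i.D x).1.1)
    (lam : (geo9K i).Loc) (γ : ℝ) (p : XBK κ i) : |evBK (κ := κ) i lam p| ≤ (geo9K i).len (blkBK i bI p) ^ γ * (geo9K i).wNorm γ lam := by
  have hlen : (geo9K i).len (blkBK (κ := κ) i bI p) = ((ℓ : ℝ) + 1) ^ (blkV1 i.hN i.D p.1).1.1 * |i.cf|⁻¹ := len_bI_eq i hlev p.1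
  rw [hlen]
  cases lam with
  | inl f =>
      show |(0 : ℝ)| ≤ _
      rw [abs_zero]
      exact mul_nonneg (Real.rpow_nonneg (mul_nonneg (pow_nonneg (by positivity) _) (inv_nonneg.2 (abs_nonneg _))) _) (geo9K_wNorm_nonneg i γ _)
  | inr J =>
      refine (abs_evDiagK_le J p).trans ?_
      have h := abs_le_of_wNormB_le i (le_refl (wNormB i γ J)) p.1
      rw [mul_comm] at h
      push_cast at h
      exact h

omit [FiniteDimensional ℝ 𝔸] [Fintype κ] [DecidableEq κ] in
/-- the knit's coordinate bound at a point over the fine bond `x`, rewritten in the scale length `lenFB i x` (LEVEL-FAITHFUL `bI`).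
[cite: Balaban1985BackgroundPropagators, (3.41) p.397, bookkeeping] -/
theorem len_blkBK_eq {bI : FBondY i → IBondY i} (hlev : ∀ x : FBondY i, lvl i.hN i.D i.hk (bI x) = (blkV1 i.hN i.D x).1.1) (p : XBK κ i) :
    (geo9K i).len (blkBK (κ := κ) i bI p) = lenFB i p.1 := len_bI_eq i hlev p.1

omit [FiniteDimensional ℝ 𝔸] [Fintype κ] in
/-- on bond arguments the evaluation IS the diagonal evaluation. [cite: Balaban1985BackgroundPropagators, (3.39) p.397, bookkeeping] -/
theorem evBK_inr (J : FBondY i → ℝ) : evBK (κ := κ) i (Sum.inr J) = evDiagK J := rfl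

end Core

/-! ## §2 ★★ The two (3.47) species on the coordinate model, entries 0–3 -/

section Glob

variable (i : KIdx d ℓ hd hL b₀ b₁) (b : Module.Basis κ ℝ 𝔸) (B : B9.Backgrounds) (cfg : B.Cfg → CfgY 𝔸 i) (O : BondOpY 𝔸 i) (par : BondParY 𝔸 i) (U₁ : B.Cfg)
variable {bI : FBondY i → IBondY i}

/-- ★★ **`CoReadsGlob … 0 U₁ (blkBK bI) (blkBK bI) evBK (GcoK …)`** for EVERY bond-sector letter and EVERY `U₁` (n06-l's species; `bI` level-faithful).
[cite: Balaban1985BackgroundPropagators, (3.41) p.397 + (3.47) p.398; Balaban1984PropagatorsII, (2.51) p.232] -/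
theorem coReadsGlob_kernelFamilyB_coords_zero (hlev : ∀ x : FBondY i, lvl i.hN i.D i.hk (bI x) = (blkV1 i.hN i.D x).1.1) :
    CoReadsGlob (kernelFamilyB i B cfg O par) 0 U₁ (blkBK i bI) (blkBK i bI) (evBK i) (GcoK i b B cfg O U₁) := by
  refine ⟨fun lam γ p => evBK_wbound i hlev lam γ p, ?_⟩
  intro lam γ C hC hx
  cases lam with
  | inl f => exact hC
  | inr J =>
      refine glob_zero_le_of_pointwise i B cfg O par U₁ J γ hC fun E x => ?_
      refine norm_le_of_coordModel_le_pt i b (fun _ : Fin (d + 1) => (O (cfg U₁)).restrictScalars ℝ) J x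
        (mul_nonneg hC (Real.rpow_nonneg (lenFB_pos i x).le _)) (fun ν cc cc' => ?_) E 0
      have h := hx (x, ν, cc, cc')
      rw [len_blkBK_eq i hlev, evBK_inr] at h
      simp only [B9.pref4, Matrix.cons_val_zero] at h
      rw [mul_assoc, sq_mul_rpow_lenFB] at h
      exact h

/-- ★★ **`CoReadsGlob … 1 U₁ (blkBK bI) (blkBK bI) evBK (DcoK ∘ₗ GcoK)`**. [cite: Balaban1985BackgroundPropagators, (3.41) p.397 + (3.47) p.398] -/
theorem coReadsGlob_kernelFamilyB_coords_one (hlev : ∀ x : FBondY i, lvl i.hN i.D i.hk (bI x) = (blkV1 i.hN i.D x).1.1) :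
    CoReadsGlob (kernelFamilyB i B cfg O par) 1 U₁ (blkBK i bI) (blkBK i bI) (evBK i) (DcoK i b B cfg U₁ ∘ₗ GcoK i b B cfg O U₁) := by
  refine ⟨fun lam γ p => evBK_wbound i hlev lam γ p, ?_⟩
  intro lam γ C hC hx
  cases lam with
  | inl f => exact hC
  | inr J =>
      rw [DcoK_comp_GcoK] at hx
      refine glob_one_le_of_pointwise i B cfg O par U₁ J γ hC fun E ν x => ?_
      refine norm_le_of_coordModel_le_pt i b (fun ν => cdBₗ i (cfg U₁) ν ∘ₗ (O (cfg U₁)).restrictScalars ℝ) J x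
        (mul_nonneg hC (Real.rpow_nonneg (lenFB_pos i x).le _)) (fun ν' cc cc' => ?_) E ν
      have h := hx (x, ν', cc, cc')
      rw [len_blkBK_eq i hlev, evBK_inr] at h
      simp only [B9.pref4, Matrix.cons_val_one, Matrix.cons_val_zero] at h
      rw [mul_assoc, mul_rpow_lenFB] at h
      exact h

/-- ★★ **`CoReadsGlob … 2 U₁ (blkBK bI) (blkBK bI) evBK (GcoK ∘ₗ DscoK)`**. [cite: Balaban1985BackgroundPropagators, (3.41) p.397 + (3.47) p.398] -/
theorem coReadsGlob_kernelFamilyB_coords_two (hlev : ∀ x : FBondY i, lvl i.hN i.D i.hk (bI x) = (blkV1 i.hN i.D x).1.1) :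
    CoReadsGlob (kernelFamilyB i B cfg O par) 2 U₁ (blkBK i bI) (blkBK i bI) (evBK i) (GcoK i b B cfg O U₁ ∘ₗ DscoK i b B cfg U₁) := by
  refine ⟨fun lam γ p => evBK_wbound i hlev lam γ p, ?_⟩
  intro lam γ C hC hx
  cases lam with
  | inl f => exact hC
  | inr J =>
      rw [GcoK_comp_DscoK] at hx
      refine glob_two_le_of_pointwise i B cfg O par U₁ J γ hC fun E ν x => ?_
      have key := norm_le_of_coordModel_le_pt i b (fun ν => (O (cfg U₁)).restrictScalars ℝ ∘ₗ cdsBₗ i (cfg U₁) ν) J x (g := C * lenFB i x ^ ((1 : ℝ) + γ))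
        (mul_nonneg hC (Real.rpow_nonneg (lenFB_pos i x).le _)) (fun ν' cc cc' => ?_) E ν
      · exact key
      have h := hx (x, ν', cc, cc')
      rw [len_blkBK_eq i hlev, evBK_inr] at h
      simp only [B9.pref4, Matrix.cons_val_two, Matrix.tail_cons, Matrix.head_cons] at h
      rw [mul_assoc, mul_rpow_lenFB] at h
      exact h

/-- ★★ **`CoReadsGlob … 3 U₁ (blkBK bI) (blkBK bI) evBK (LcoK ∘ₗ GcoK)`**. [cite: Balaban1985BackgroundPropagators, (3.41) p.397 + (3.47) p.398] -/
theorem coReadsGlob_kernelFamilyB_coords_three (hlev : ∀ x : FBondY i, lvl i.hN i.D i.hk (bI x) = (blkV1 i.hN i.D x).1.1) :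
    CoReadsGlob (kernelFamilyB i B cfg O par) 3 U₁ (blkBK i bI) (blkBK i bI) (evBK i) (LcoK i b B cfg U₁ ∘ₗ GcoK i b B cfg O U₁) := by
  refine ⟨fun lam γ p => evBK_wbound i hlev lam γ p, ?_⟩
  intro lam γ C hC hx
  cases lam with
  | inl f => exact hC
  | inr J =>
      rw [LcoK_comp_GcoK] at hx
      refine glob_three_le_of_pointwise i B cfg O par U₁ J γ hC fun E x => ?_
      have key := norm_le_of_coordModel_le_pt i b (fun _ : Fin (d + 1) => lapBₗ i (cfg U₁) ∘ₗ (O (cfg U₁)).restrictScalars ℝ) J x (g := C * lenFB i x ^ γ)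
        (mul_nonneg hC (Real.rpow_nonneg (lenFB_pos i x).le _)) (fun ν cc cc' => ?_) E 0
      · simpa only [LinearMap.comp_apply, lapBₗ_apply, LinearMap.coe_restrictScalars] using key
      have h := hx (x, ν, cc, cc')
      rw [len_blkBK_eq i hlev, evBK_inr] at h
      simp only [B9.pref4, Matrix.cons_val_three, Matrix.tail_cons, Matrix.head_cons, mul_one] at h
      exact h

/-- ★★ **`GlobReads … 0 U₁ (blkBK bI) (blkBK bI) evBK (GcoK …)`** (n06-k's species: `wnorm_nonneg` + the combined exponent `len^{2+γ}`).
[cite: Balaban1985BackgroundPropagators, (3.41) p.397 + (3.47) p.398] -/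
theorem globReads_kernelFamilyB_coords_zero (hlev : ∀ x : FBondY i, lvl i.hN i.D i.hk (bI x) = (blkV1 i.hN i.D x).1.1) :
    GlobReads (kernelFamilyB i B cfg O par) 0 U₁ (blkBK i bI) (blkBK i bI) (evBK i) (GcoK i b B cfg O U₁) := by
  refine ⟨fun lam γ p => evBK_wbound i hlev lam γ p, fun lam γ => geo9K_wNorm_nonneg i γ lam, ?_⟩
  intro lam γ C hC hx
  cases lam with
  | inl f => exact hC
  | inr J =>
      refine glob_zero_le_of_pointwise i B cfg O par U₁ J γ hC fun E x => ?_
      refine norm_le_of_coordModel_le_pt i b (fun _ : Fin (d + 1) => (O (cfg U₁)).restrictScalars ℝ) J x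
        (mul_nonneg hC (Real.rpow_nonneg (lenFB_pos i x).le _)) (fun ν cc cc' => ?_) E 0
      have h := hx (x, ν, cc, cc')
      rw [len_blkBK_eq i hlev, evBK_inr] at h
      simp only [Matrix.cons_val_zero] at h
      exact h

/-- ★★ **`GlobReads … 1 U₁ (blkBK bI) (blkBK bI) evBK (DcoK ∘ₗ GcoK)`**. [cite: Balaban1985BackgroundPropagators, (3.41) p.397 + (3.47) p.398] -/
theorem globReads_kernelFamilyB_coords_one (hlev : ∀ x : FBondY i, lvl i.hN i.D i.hk (bI x) = (blkV1 i.hN i.D x).1.1) :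
    GlobReads (kernelFamilyB i B cfg O par) 1 U₁ (blkBK i bI) (blkBK i bI) (evBK i) (DcoK i b B cfg U₁ ∘ₗ GcoK i b B cfg O U₁) := by
  refine ⟨fun lam γ p => evBK_wbound i hlev lam γ p, fun lam γ => geo9K_wNorm_nonneg i γ lam, ?_⟩
  intro lam γ C hC hx
  cases lam with
  | inl f => exact hC
  | inr J =>
      rw [DcoK_comp_GcoK] at hx
      refine glob_one_le_of_pointwise i B cfg O par U₁ J γ hC fun E ν x => ?_
      refine norm_le_of_coordModel_le_pt i b (fun ν => cdBₗ i (cfg U₁) ν ∘ₗ (O (cfg U₁)).restrictScalars ℝ) J x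
        (mul_nonneg hC (Real.rpow_nonneg (lenFB_pos i x).le _)) (fun ν' cc cc' => ?_) E ν
      have h := hx (x, ν', cc, cc')
      rw [len_blkBK_eq i hlev, evBK_inr] at h
      simp only [Matrix.cons_val_one, Matrix.cons_val_zero] at h
      exact h

/-- ★★ **`GlobReads … 2 U₁ (blkBK bI) (blkBK bI) evBK (GcoK ∘ₗ DscoK)`**. [cite: Balaban1985BackgroundPropagators, (3.41) p.397 + (3.47) p.398] -/
theorem globReads_kernelFamilyB_coords_two (hlev : ∀ x : FBondY i, lvl i.hN i.D i.hk (bI x) = (blkV1 i.hN i.D x).1.1) :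
    GlobReads (kernelFamilyB i B cfg O par) 2 U₁ (blkBK i bI) (blkBK i bI) (evBK i) (GcoK i b B cfg O U₁ ∘ₗ DscoK i b B cfg U₁) := by
  refine ⟨fun lam γ p => evBK_wbound i hlev lam γ p, fun lam γ => geo9K_wNorm_nonneg i γ lam, ?_⟩
  intro lam γ C hC hx
  cases lam with
  | inl f => exact hC
  | inr J =>
      rw [GcoK_comp_DscoK] at hx
      refine glob_two_le_of_pointwise i B cfg O par U₁ J γ hC fun E ν x => ?_
      have key := norm_le_of_coordModel_le_pt i b (fun ν => (O (cfg U₁)).restrictScalars ℝ ∘ₗ cdsBₗ i (cfg U₁) ν) J x (g := C * lenFB i x ^ ((1 : ℝ) + γ))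
        (mul_nonneg hC (Real.rpow_nonneg (lenFB_pos i x).le _)) (fun ν' cc cc' => ?_) E ν
      · exact key
      have h := hx (x, ν', cc, cc')
      rw [len_blkBK_eq i hlev, evBK_inr] at h
      simp only [Matrix.cons_val_two, Matrix.tail_cons, Matrix.head_cons] at h
      exact h

/-- ★★ **`GlobReads … 3 U₁ (blkBK bI) (blkBK bI) evBK (LcoK ∘ₗ GcoK)`**. [cite: Balaban1985BackgroundPropagators, (3.41) p.397 + (3.47) p.398] -/
theorem globReads_kernelFamilyB_coords_three (hlev : ∀ x : FBondY i, lvl i.hN i.D i.hk (bI x) = (blkV1 i.hN i.D x).1.1) :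
    GlobReads (kernelFamilyB i B cfg O par) 3 U₁ (blkBK i bI) (blkBK i bI) (evBK i) (LcoK i b B cfg U₁ ∘ₗ GcoK i b B cfg O U₁) := by
  refine ⟨fun lam γ p => evBK_wbound i hlev lam γ p, fun lam γ => geo9K_wNorm_nonneg i γ lam, ?_⟩
  intro lam γ C hC hx
  cases lam with
  | inl f => exact hC
  | inr J =>
      rw [LcoK_comp_GcoK] at hx
      refine glob_three_le_of_pointwise i B cfg O par U₁ J γ hC fun E x => ?_
      have key := norm_le_of_coordModel_le_pt i b (fun _ : Fin (d + 1) => lapBₗ i (cfg U₁) ∘ₗ (O (cfg U₁)).restrictScalars ℝ) J x (g := C * lenFB i x ^ γ)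
        (mul_nonneg hC (Real.rpow_nonneg (lenFB_pos i x).le _)) (fun ν cc cc' => ?_) E 0
      · simpa only [LinearMap.comp_apply, lapBₗ_apply, LinearMap.coe_restrictScalars] using key
      have h := hx (x, ν, cc, cc')
      rw [len_blkBK_eq i hlev, evBK_inr] at h
      simp only [Matrix.cons_val_three, Matrix.tail_cons, Matrix.head_cons, zero_add] at h
      exact h

end Glob

end Literature.MathematicalPhysics.QuantumFieldTheory.Balaban1983to89.B9CoReadingCoordsGlob

end
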